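import Literature.NumberTheory.Rogawski1990.TwistedComparisonSpectralSide                  -- ★ the §13.5–13.10 dictionary: `TwistedComparisonData`, `Laws`
import Summits.HodgeConjecture.HodgeConjecture.Theorems.F0P3cDbTEnvelopeTrichotomy         -- ★ brings `MemXiFamily`, `xiLocalChar`, the constituent currency (as in S5 file D)
import Literature.NumberTheory.Rogawski1990.CharIdentityOnTestFunctionsSigned              -- ★ `CMLocalAPacket.CharIdentityAtTest` with signed member traces
import Summits.HodgeConjecture.HodgeConjecture.Theorems.F0P3cStCharTSCharField             -- ★ `qsForm_map_cmConjRingHom_transpose` : `(σΦ₃)ᵀ = Φ₃`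
import Summits.HodgeConjecture.HodgeConjecture.Theorems.F0P3cStCharTSShellOrbitalGCan      -- ★ `F0P3cStCharTSShellOrbitalG.isUnit_det_qsForm` : `IsUnit (det Φ₃)`
import HarnessLib

/-!
# R90-TF · S5 «Ch. 13.3 multiplicity ∕ rigidity» — DEFS LEAF `R90S5QsDictionaryPins`: the HELPER PREDICATE `QsPinnedXiDatumAt` «a lawful ★ twisted-comparison datum on
# GIVEN carriers reads the instance (L, P, ξ, v)» — PER INSTANCE, carriers as PARAMETERS (LEAD #16 (A2), S5 RULING 15:53:03Z (E1)(E2))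

Cell `hodgecm-mathlib`, crux H413 (`stmt-HodgeConjecture-24833`), route of record `HCCMUnconditional`; programme R90-TF (brief `director/R90-BRIEF.v2.md`
1f40d54518340a35), section S5 = Ch. 13.3 (base `R90-C133`), seat R90-C133-p01 (g0); R90-C133-plan (g0) DEAL #5 «PIN-BYTES PROTOCOL» 2026-09-04T15:43:54Z («a defs-only
sorry-free file `Theorems/R90S5QsDictionaryPins.lean` (ns `…R90.S5`): the dictionary→record PIN PREDICATES … kit-free, C5 datum-first»).  DEFS ONLY: ONE `def … : Prop` with
body + its `Iff.rfl` unfolding; no instance, no notation, no axiom, no `sorry`.  Route-posited vocabulary over Summits-side currency (`MemXiFamily`, `DiscreteAutomorphicRep`,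
`CMLocalAPacket.CharIdentityAtTest`, ★ dictionary `TwistedComparisonData`) — a `Theorems/…Defs`-type leaf, NOT a Literature fact (locators spelled `(print: …)` in the def's
docstring, ★ `K2E1TraceFormulaBetaDefs` GATE NOTE convention, so the gate's inline-fact relocation does not lift it).
HONEST LABEL: HC_CM is proved only modulo the 7 printed citations (2 remaining named inputs: hLiu418 = stmt-HodgeConjecture-24832, h413 = stmt-HodgeConjecture-24833)
until rung 0 closes; this file ASSERTS NOTHING.  **HELPER PREDICATE, NOT the J-S5→S10 junction socket** (S5 RULING 15:53:03Z (E2), LEAD #16 (A2)): its (P4) conjunct carries the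
membership content («`P_v ∈ {πⁿ ∘ e, πˢ}`») unless `𝔨` is PINNED to the functionals ∕ classes of record — with an unpinned junk `𝔨` (`m := 1`, one packet, `mem := True`; the
zero datum satisfies all of `Laws`, R90-C138-audit1 probe 12e449544a92e8e6) (P4) ∧ (P5) read the local conclusion outright, so this predicate is an honest ★-level
REFORMULATION of «(β) at the instance, routed through print's §13.10», not a weaker upstream; the junction socket proper is typed by the S5 dealer in D ED. 3 over S10's
PINNED datum (carriers of record, `MainEquality`'s distributions = S6∕S8's defined functionals `ov_cm` …; S10 FILE D ED. 2, LEAD #16 (A3)) and will IMPLY this predicate.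

## WHY PER INSTANCE (`∃ 𝔨` AFTER the record binders), not «one bound datum `𝔨` reading every `P`»
The ★ dictionary datum is typed AT A FIXED LEVEL `S` (★ `TwistedComparisonSpectralSide` :60–:62 «AT A FIXED finite set `S` of places … containing … all ramification»;
`Germ` :89 = «e.v.p.'s OFF `S`, EXACT»; `trS` :95 = «`Tr π_S(f_S)` for a discrete `π` unramified off `S`»).  (QS-U) ∕ (β)@Φ₃ quantify over ALL discrete `P` of `U(Φ₃)` (unbounded
ramification) and all `ξ`, `v`; so the datum that reads `(P, ξ, v)` must be allowed to depend on them (print enlarges `S` as needed, §13.8 p. 213 «we implicitly assume …»).  Hence the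
pin predicate binds the record objects FIRST and posits `∃ 𝔨 : TwistedComparisonData TGt TG TH, 𝔨.Laws ∧ ∃ cls ξH πsRec, pins` ON GIVEN CARRIERS `TGt TG TH` (parameters — NO `∃`
over `Type`, S5 RULING (E1): the junction instantiates them at the carriers of record) — a `Prop`-valued package cannot carry the readings `cls ∕ ξH ∕ πsRec` as data fields
anyway (they are ∃-bound).  Packing the carriers, this is the hypothesis `HPins` of ★ `rigidCoreScQs_of_pinnedXiData` (p861519) read at one instance, now NAMED
(bridge BY NAME: `rigidCoreScQs_of_forall_qsPinnedXiDatumAt`, sibling file).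

## THE PINS (print anchors) — rows J-S5→S10-1…6 of CENSUS `R90/S5/R90-C133-p01/CENSUS-SocketQsXiRigidity.md`
(P1) `cls`, `𝔨.𝔊.m cls ≠ 0` — «`P` read in the dictionary; `P` occurs discretely» [§13.3 p. 201; §14.5 p. 238].  (P2) `ξH`, `𝔨.IsOneDimH ξH`, `¬ 𝔨.𝔊.IsTheta ξH` — «`ξ` read in
`Π(H)`, one-dimensional, not `ρ(θ)`» [§13.3 p. 202; Lemma 13.6.3 (c) p. 211].  (P3) `MemXiFamily P … ξ → 𝔨.germRep cls = 𝔨.germI ξH` — «an envelope member has the string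
`ψ_G(t(P)) = t(I_{ξ̃′})`» = ROAD γ (★ p861443 `xiString_exists_finset_evpAtIntegralLevel_eq` ∕ `_evp_eq_psiG_evp`) composed with the datum's e.v.p. pin pair (π1)(π2) of p03's CENSUS
(c) («`germRep (cls P) = germOfEvp (evpAtIntegralLevel … (clFinChoice P) S hP)`», «`germI (ξH ξ) = germOfEvp (evpAtIntegralLevel … (v ↦ (xiFamilyOfRecord ξ v).πn) S hξ)`», `germOfEvp`
injective = `HatInjective`) — (P3) is the WEAKEST form the (β)-composition needs; the (π1)(π2) form implies it by γ-evp [§13.6 p. 210; Prop 13.2.2 (d)].  (P4) `πsRec` + «`cls ∈ Π(ξH)`,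
`Π(ξH)` the A-packet `ξH ↦ Π` ⇒ every `v`-constituent of `P` is `πⁿ(ξ_v) ∘ e` or `πsRec`» — «`π_v ∈ Π(ξ_v) = {πⁿ(ξ_v), πˢ(ξ_v)}`» read at the non-split place `v` [§13.3 p. 201; §13.1
p. 199 l. 6] (E-S4 ∕ S1 local packet of record; for the all-places reading p02's (U-R) needs, an ED. 2 conjunct).  (P5) `⟨πⁿ ∘ e, some πsRec⟩` satisfies the SIGNED [13.1.4] on test
functions at `(ξ_v, ν, Δ_v, m)` with the frame sign — S3's letter [Prop 13.1.4 p. 199; §4.9 p. 55]; at the D-record choice `πsRec := ((hQS ξ).1 v …).πs` it is ★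
`CMNonsplitCharIdentityAtTestSigned.charIdentityAtTestSigned_πs`, and every signed partner equals that one (★ `eq_πs_of_charIdentityAtTestSigned`, p861449).
NOT a pin: `𝔨.Laws` (the printed relations, class P of the ★ dictionary) — the CONTENT socket; NOTE for S10 (R90-C138): the ξ-line laws `CoeffEndoscopic`∕`APacketLift` at a
one-dimensional `ξ` carry the twisted trace `trIS ξ` = `Tr(I_{ξ̃′,S}(φ_S) I(ε))`, genuinely non-zero — the «ZERO TWISTED SLICE» of SOCKET-PLAN-S10 v1.1 R1 (13.8.3 for `St_H`, `φ_u`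
stably null) does not serve this line as is.

References: [Rogawski1990] §13.3 pp. 201–203 (Thm 13.3.5, 13.3.6 (c), 13.3.7); §13.6 p. 209–211; §13.7 p. 212–213; §13.8 Prop 13.8.1 p. 213; §13.10 pp. 230–231; §13.1 Prop 13.1.3 (d),
Prop 13.1.4 p. 199; §4.9 p. 55.  [LanglandsShelstad1987] §1.
-/

set_option autoImplicit false
-- the mandated namespace repeats the single-problem summit's segment (`HodgeConjecture.HodgeConjecture`)
set_option linter.dupNamespace false

noncomputable section

open NumberField IsDedekindDomain MeasureTheory
open scoped Matrix ComplexOrder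

open Literature.NumberTheory Literature.NumberTheory.Automorphic Literature.NumberTheory.Automorphic.UnitaryGroup
open Literature.NumberTheory.Automorphic.IdeleClassGroup
open Literature.NumberTheory.GaloisRepresentations
open Literature.NumberTheory.Rogawski1990
open Summit.HodgeConjecture.HodgeConjecture.Cruxes.H413

namespace Summit.HodgeConjecture.HodgeConjecture.R90.S5

open scoped Classical in
/-- **`QsPinnedXiDatumAt TGt TG TH … P ξ v … πn` — HELPER PREDICATE «a lawful ξ-line datum on the carriers `TGt TG TH` reads the instance
`(L; Δ_v, m_{H,v}, m_{G,v}, ν_{G,v}, ν_{H,v}; μ, ξ; P; v; frame (T, a); πⁿ)`»** (per instance; NOT the junction socket — see the module docstring): there is a ★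
twisted-comparison datum `𝔨` on the GIVEN test-function carriers (Rogawski §13.5–13.10 as a typed dictionary) satisfying the printed relations
`𝔨.Laws`, together with READINGS `cls ∈ 𝔨.𝔊.Rep` of `P`, `ξH ∈ 𝔨.𝔊.PacketH` of `ξ` and a class `πsRec` of `U(Φ₃)(L⁺_v)` («the record `πˢ(ξ_v)`») such that: (P1) `m(cls) ≠ 0`; (P2) `ξH`
is one-dimensional and not `ρ(θ)`; (P3) if `P` lies in the `ξ`-envelope then `ψ_G(t(P)) = t(I_{ξ̃′})` (`germRep cls = germI ξH`); (P4) membership of `cls` in the A-packet `Π(ξH)`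
READ AT `v`: every `v`-constituent of `P` is `πⁿ ∘ e` or `πsRec` (`e⁻¹ = cmDatumLocalCongr L v T ha h`); (P5) `⟨πⁿ ∘ e, some πsRec⟩` satisfies the SIGNED [13.1.4] on test functions at
`(ξ.xiLocalChar v, ν_{H,v}, Δ_v, m_{H,v}, m_{G,v})` with the frame sign `ε_v = (if ∃ z unit, a = z·σz then 1 else −1)`.  Its ∀-closure over the (QS-U) binder prefix implies the
hypothesis of ★ `rigidCoreScQs_of_pinnedXiData` (⟹ (β)@Φ₃ ⟹ (QS-U) ⟹ (QS-R) = S5#4); with an UNPINNED `𝔨` (P4) ∧ (P5) already read the local conclusion (helper, not socket).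
(print: Rogawski1990, §13.10 pp. 230–231; Thm 13.3.7 p. 203; §13.3 p. 201; §13.6 p. 210; §13.1 p. 199, Prop 13.1.3 (d), Prop 13.1.4; §4.9 p. 55) -/
def QsPinnedXiDatumAt (TGt TG TH : Type) (L : Type) [Field L] [NumberField L] [IsCMField L]
    (v : HeightOneSpectrum (𝓞 ↥(maximalRealSubfield L)))
    [MeasurableSpace ((cmDatum L 3 (qsForm L)).Local v)]
    [MeasurableSpace ((cmDatum L 2 (Matrix.of fun i j : Fin 2 => if i.val + j.val + 1 = 2 then (1 : L) else 0)).Local v ×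
      (cmDatum L 1 (Matrix.of fun i j : Fin 1 => if i.val + j.val + 1 = 1 then (1 : L) else 0)).Local v)]
    [∀ a : ((cmDatum L 2 (Matrix.of fun i j : Fin 2 => if i.val + j.val + 1 = 2 then (1 : L) else 0)).Local v ×
        (cmDatum L 1 (Matrix.of fun i j : Fin 1 => if i.val + j.val + 1 = 1 then (1 : L) else 0)).Local v),
      MeasurableSpace (((cmDatum L 2 (Matrix.of fun i j : Fin 2 => if i.val + j.val + 1 = 2 then (1 : L) else 0)).Local v ×
        (cmDatum L 1 (Matrix.of fun i j : Fin 1 => if i.val + j.val + 1 = 1 then (1 : L) else 0)).Local v) ⧸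
        Subgroup.centralizer ({a} : Set ((cmDatum L 2 (Matrix.of fun i j : Fin 2 => if i.val + j.val + 1 = 2 then (1 : L) else 0)).Local v ×
        (cmDatum L 1 (Matrix.of fun i j : Fin 1 => if i.val + j.val + 1 = 1 then (1 : L) else 0)).Local v)))]
    [∀ γ : (cmDatum L 3 (qsForm L)).Local v,
      MeasurableSpace ((cmDatum L 3 (qsForm L)).Local v ⧸ Subgroup.centralizer ({γ} : Set ((cmDatum L 3 (qsForm L)).Local v)))]
    (Δv : LocalTransferFactor L (qsForm L) v)
    (mHv : OrbitalMeasureFamily ((cmDatum L 2 (Matrix.of fun i j : Fin 2 => if i.val + j.val + 1 = 2 then (1 : L) else 0)).Local v ×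
        (cmDatum L 1 (Matrix.of fun i j : Fin 1 => if i.val + j.val + 1 = 1 then (1 : L) else 0)).Local v))
    (mGv : OrbitalMeasureFamily ((cmDatum L 3 (qsForm L)).Local v))
    (νGv : Measure ((cmDatum L 3 (qsForm L)).Local v))
    (νHv : Measure ((cmDatum L 2 (Matrix.of fun i j : Fin 2 => if i.val + j.val + 1 = 2 then (1 : L) else 0)).Local v ×
        (cmDatum L 1 (Matrix.of fun i j : Fin 1 => if i.val + j.val + 1 = 1 then (1 : L) else 0)).Local v))
    (μω : HeckeCharacter L) (hμu : μω.IsUnitary) (ξ : OneDimAutRepH L)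
    (μA : Measure (adelicGroupData (↥(maximalRealSubfield L)) L (IsCMField.complexConj L) 3 (qsForm L)).automorphicQuotient)
    [(adelicGroupData (↥(maximalRealSubfield L)) L (IsCMField.complexConj L) 3 (qsForm L)).IsAutomorphicMeasure μA]
    (P : DiscreteAutomorphicRep (adelicGroupData (↥(maximalRealSubfield L)) L (IsCMField.complexConj L) 3 (qsForm L)) μA)
    (T : GL (Fin 3) (LocalRing L v)) (a : LocalRing L v) (ha : IsUnit a)
    (h : formCongr (conjLocal L (IsCMField.complexConj L) v) T ((qsForm L).map (algebraMap L (LocalRing L v))) =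
      a • (Matrix.of fun i j : Fin 3 => if i.val + j.val + 1 = 3 then (1 : L) else 0).map (algebraMap L (LocalRing L v)))
    (πn : IrrClass (Gqs L v)) : Prop :=
  ∃ 𝔨 : TwistedComparisonData TGt TG TH, 𝔨.Laws ∧
    ∃ (cls : 𝔨.𝔊.Rep) (ξH : 𝔨.𝔊.PacketH) (πsRec : IrrClass ((cmDatum L 3 (qsForm L)).Local v)),
      𝔨.𝔊.m cls ≠ 0 ∧ 𝔨.IsOneDimH ξH ∧ ¬ 𝔨.𝔊.IsTheta ξH ∧
      (MemXiFamily P (F0P3cStCharTSCharField.qsForm_map_cmConjRingHom_transpose L) (F0P3cStCharTSShellOrbitalG.isUnit_det_qsForm L) μω hμu ξ →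
        𝔨.germRep cls = 𝔨.germI ξH) ∧
      (∀ Pk : 𝔨.𝔊.Packet, 𝔨.𝔊.IsAPacket Pk → 𝔨.𝔊.liftsTo ξH Pk → 𝔨.𝔊.mem cls Pk →
        ∀ c : IrrClass ((cmDatum L 3 (qsForm L)).Local v),
          (IrrClass.comap (localPiEquiv L (IsCMField.complexConj L) 3 (qsForm L) v) c).IsConstituentOf
              (P.finRep.smoothPart.toRepresentation.comp (inclPlace (↥(maximalRealSubfield L)) L (IsCMField.complexConj L) 3 (qsForm L) v)) →
          c = IrrClass.comap (cmDatumLocalCongr L v T ha h).symm πn ∨ c = πsRec) ∧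
      (⟨IrrClass.comap (cmDatumLocalCongr L v T ha h).symm πn, some πsRec⟩ : CMLocalAPacket L (qsForm L) v).CharIdentityAtTest L (qsForm L) v
        (fun c' f => (if ∃ z : LocalRing L v, IsUnit z ∧ a = z * conjLocal L (IsCMField.complexConj L) v z then (1 : ℂ) else -1) *
        c'.smoothTrace νGv f)
        (ξ.xiLocalChar v) νHv Δv mHv mGv

open scoped Classical in
/-- Unfolding of `QsPinnedXiDatumAt`, token for token. [cite: Rogawski1990, §13.10 pp. 230–231] -/
theorem qsPinnedXiDatumAt_iff (TGt TG TH : Type) (L : Type) [Field L] [NumberField L] [IsCMField L]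
    (v : HeightOneSpectrum (𝓞 ↥(maximalRealSubfield L)))
    [MeasurableSpace ((cmDatum L 3 (qsForm L)).Local v)]
    [MeasurableSpace ((cmDatum L 2 (Matrix.of fun i j : Fin 2 => if i.val + j.val + 1 = 2 then (1 : L) else 0)).Local v ×
      (cmDatum L 1 (Matrix.of fun i j : Fin 1 => if i.val + j.val + 1 = 1 then (1 : L) else 0)).Local v)]
    [∀ a : ((cmDatum L 2 (Matrix.of fun i j : Fin 2 => if i.val + j.val + 1 = 2 then (1 : L) else 0)).Local v ×
        (cmDatum L 1 (Matrix.of fun i j : Fin 1 => if i.val + j.val + 1 = 1 then (1 : L) else 0)).Local v),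
      MeasurableSpace (((cmDatum L 2 (Matrix.of fun i j : Fin 2 => if i.val + j.val + 1 = 2 then (1 : L) else 0)).Local v ×
        (cmDatum L 1 (Matrix.of fun i j : Fin 1 => if i.val + j.val + 1 = 1 then (1 : L) else 0)).Local v) ⧸
        Subgroup.centralizer ({a} : Set ((cmDatum L 2 (Matrix.of fun i j : Fin 2 => if i.val + j.val + 1 = 2 then (1 : L) else 0)).Local v ×
        (cmDatum L 1 (Matrix.of fun i j : Fin 1 => if i.val + j.val + 1 = 1 then (1 : L) else 0)).Local v)))]
    [∀ γ : (cmDatum L 3 (qsForm L)).Local v,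
      MeasurableSpace ((cmDatum L 3 (qsForm L)).Local v ⧸ Subgroup.centralizer ({γ} : Set ((cmDatum L 3 (qsForm L)).Local v)))]
    (Δv : LocalTransferFactor L (qsForm L) v)
    (mHv : OrbitalMeasureFamily ((cmDatum L 2 (Matrix.of fun i j : Fin 2 => if i.val + j.val + 1 = 2 then (1 : L) else 0)).Local v ×
        (cmDatum L 1 (Matrix.of fun i j : Fin 1 => if i.val + j.val + 1 = 1 then (1 : L) else 0)).Local v))
    (mGv : OrbitalMeasureFamily ((cmDatum L 3 (qsForm L)).Local v))
    (νGv : Measure ((cmDatum L 3 (qsForm L)).Local v))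
    (νHv : Measure ((cmDatum L 2 (Matrix.of fun i j : Fin 2 => if i.val + j.val + 1 = 2 then (1 : L) else 0)).Local v ×
        (cmDatum L 1 (Matrix.of fun i j : Fin 1 => if i.val + j.val + 1 = 1 then (1 : L) else 0)).Local v))
    (μω : HeckeCharacter L) (hμu : μω.IsUnitary) (ξ : OneDimAutRepH L)
    (μA : Measure (adelicGroupData (↥(maximalRealSubfield L)) L (IsCMField.complexConj L) 3 (qsForm L)).automorphicQuotient)
    [(adelicGroupData (↥(maximalRealSubfield L)) L (IsCMField.complexConj L) 3 (qsForm L)).IsAutomorphicMeasure μA]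
    (P : DiscreteAutomorphicRep (adelicGroupData (↥(maximalRealSubfield L)) L (IsCMField.complexConj L) 3 (qsForm L)) μA)
    (T : GL (Fin 3) (LocalRing L v)) (a : LocalRing L v) (ha : IsUnit a)
    (h : formCongr (conjLocal L (IsCMField.complexConj L) v) T ((qsForm L).map (algebraMap L (LocalRing L v))) =
      a • (Matrix.of fun i j : Fin 3 => if i.val + j.val + 1 = 3 then (1 : L) else 0).map (algebraMap L (LocalRing L v)))
    (πn : IrrClass (Gqs L v)) :
    QsPinnedXiDatumAt TGt TG TH L v Δv mHv mGv νGv νHv μω hμu ξ μA P T a ha h πn ↔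
      ∃ 𝔨 : TwistedComparisonData TGt TG TH, 𝔨.Laws ∧
        ∃ (cls : 𝔨.𝔊.Rep) (ξH : 𝔨.𝔊.PacketH) (πsRec : IrrClass ((cmDatum L 3 (qsForm L)).Local v)),
          𝔨.𝔊.m cls ≠ 0 ∧ 𝔨.IsOneDimH ξH ∧ ¬ 𝔨.𝔊.IsTheta ξH ∧
          (MemXiFamily P (F0P3cStCharTSCharField.qsForm_map_cmConjRingHom_transpose L) (F0P3cStCharTSShellOrbitalG.isUnit_det_qsForm L) μω hμu ξ →
            𝔨.germRep cls = 𝔨.germI ξH) ∧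
          (∀ Pk : 𝔨.𝔊.Packet, 𝔨.𝔊.IsAPacket Pk → 𝔨.𝔊.liftsTo ξH Pk → 𝔨.𝔊.mem cls Pk →
            ∀ c : IrrClass ((cmDatum L 3 (qsForm L)).Local v),
              (IrrClass.comap (localPiEquiv L (IsCMField.complexConj L) 3 (qsForm L) v) c).IsConstituentOf
                  (P.finRep.smoothPart.toRepresentation.comp (inclPlace (↥(maximalRealSubfield L)) L (IsCMField.complexConj L) 3 (qsForm L) v)) →
              c = IrrClass.comap (cmDatumLocalCongr L v T ha h).symm πn ∨ c = πsRec) ∧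
          (⟨IrrClass.comap (cmDatumLocalCongr L v T ha h).symm πn, some πsRec⟩ : CMLocalAPacket L (qsForm L) v).CharIdentityAtTest L (qsForm L) v
            (fun c' f => (if ∃ z : LocalRing L v, IsUnit z ∧ a = z * conjLocal L (IsCMField.complexConj L) v z then (1 : ℂ) else -1) *
            c'.smoothTrace νGv f)
            (ξ.xiLocalChar v) νHv Δv mHv mGv :=
  Iff.rfl

end Summit.HodgeConjecture.HodgeConjecture.R90.S5

end
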